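import Summits.Ventures.AbcSig.Rows.XTemplateBC
import Summits.Ventures.AbcSig.Levels.N578

/-!
# Venture AbcSig — ROW `XnA7Yn17Z2`, the `n = 7` COMPANION (lead RULING LEAN-A7, option (ii)): `x⁷ + 2^r y⁷ = 17 z²`, `y` even

HONEST FRAMING. A row of a COMPUTATION cell (`pub-abcsig`); a CONDITIONAL theorem, no claim on ABC or any summit.
WHY THIS FILE EXISTS. The v1 Lean row `xrow_XnA7Yn17Z2` (`Rows/XnA7Yn17Z2X.lean`) quantifies the REDUCED 2-exponent
`7 ≤ α < n` (RULING H1) and is therefore VACUOUS at `n = 7`. The census row of record `census/rows/C1b/C1b-C17-a7plus.md`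
(v2, ledger id `C1br2-C17-a7plus`, R8-signed by referee ref-g57 2026-08-24T23:06Z, sha16 `d1ead1cb36861c67`) closes `n = 7`
for `α ≥ 7` AS WRITTEN under the lead's RULING A7-N7: in NORMAL FORM (`y` odd, total 2-exponent `T = α + 7·v₂(y) ≥ 7`)
the class `T ≢ 6 (mod 7)` lives at level `2·17² = 578` and the class `T ≡ 6 (mod 7)` at level `17² = 289`. Writing
`α = 7q + r` (`0 ≤ r ≤ 6`) and `Y = 2^q·y`, a primitive solution of `x⁷ + 2^α y⁷ = 17 z²` with `T ≥ 7`, `T ≢ 6 (mod 7)`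
is exactly a primitive solution of `x⁷ + 2^r Y⁷ = 17 z²` with `r ≤ 5` and `Y` EVEN (elementary; `x`, `z` stay odd, so
primitivity is preserved) — the statement proved here, for every `r ≤ 5` at once; the class `r = 6` (`T ≡ 6 (mod 7)`,
level 289) is the `n = 7` instance of the α = 6 row `xrow_Xn64Yn17Z2` (`Rows/Xn64Yn17Z2X.lean`, exponent floor 7).
TEMPLATE. `xbranchBC_v7` of `Rows/XTemplateBC.lean` (case (v₇) of [BS04, Lemma 2.1/3.2]: `y` even ⇒ `2⁷ ∣ 2^r y⁷`,
level `2C²`; `B = 2^r` is 7-th-power free since `r < 7`), family predicate `famBC r 17 7 (fun _ b => 2 ∣ b)`.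
Hypotheses: `BS04Package` (CITED: [BS04] Lemma 3.3 + (3.1) + Lemma 4.2), `DataComplete` at level 578 (COMPUTED, certified
level file `Levels/N578.lean`), and three per-orbit exclusions `hX_…` (CITED from the row of record, R3/R5):
* `orbit_578_1` (census id 578.1; rational, potentially multiplicative at 17): [BS04, Prop 4.4] AS PRINTED;
* `orbit_578_4` (census engine-1 id **578.3**: `c₃ = θ`, `c₅ = 2θ`, `θ² = 2`) and `orbit_578_2` (census id **578.4**:
  `c₃ = 0`, `c₅ = θ`): module M9, PS(ε₄) shape at `p = 17` — `f ⊗ ε̄₄ ∉ S₂(Γ₀(34), χ₁₇)` (gcd of exact integer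
  polynomials = 1 at `l = 3, 7, 11` resp. `l = 3, 11`), so `#ρ̄_{f,ν}(I₁₇) ≠ 4 = e₁₇(Frey)`; three legs each (engine-2
  certificate, p1 second implementation, referee third reading — named in the row of record); the local type at 17 does
  not see the 2-adic class, which is why the exclusion is cited for the `y`-even family at every `r`.
Everything else is kernel-checked (`Rows/XTemplateBC.lean`, `Levels/N578.lean`: at `n = 7` the sieve certificates
eliminate every other orbit; the orbits with residual `[17]` are irrelevant at `n = 7`).
p1 g14 (prover-pub-abcsig-p1-g14-0), 2026-08-25; pattern of p-lean's generated rows.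
-/

namespace Summit.Ventures.AbcSig

/-- Row `XnA7Yn17Z2`, `n = 7` companion (RULING A7-N7 normal form, class `T ≢ 6 (mod 7)`): for every `r ≤ 5` there is
no primitive solution of `x⁷ + 2^r y⁷ = 17 z²` with `y` even and `x·y ≠ ±1`, conditional on the named hypotheses. -/
theorem xrow_XnA7Yn17Z2_n7 (M : NewformModel) (hP : M.BS04Package)
    (hD578 : M.DataComplete 578 level578Orbits)
    (r : ℕ) (hr : r ≤ 5)
    (hX_orbit_578_1 : M.Excludes 578 orbit_578_1 (famBC r 17 7 (fun _ b => 2 ∣ b)))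
    (hX_orbit_578_2 : M.Excludes 578 orbit_578_2 (famBC r 17 7 (fun _ b => 2 ∣ b)))
    (hX_orbit_578_4 : M.Excludes 578 orbit_578_4 (famBC r 17 7 (fun _ b => 2 ∣ b)))
    (x y z : ℤ) (hy : 2 ∣ y) (hxy1 : x * y ≠ 1) (hxy2 : x * y ≠ -1) :
    ¬ IsPrimitiveSolution 1 (2 ^ r) 17 7 x y z := by
  have hC : Nat.Prime 17 := by norm_num
  have hsq : Squarefree (17 : ℕ) := (Nat.prime_iff.mp hC).squarefree
  have h7 : Nat.Prime 7 := by norm_num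
  exact xbranchBC_v7 r 17 hsq (by decide) M hP hD578 7 h7 (le_refl 7) (by norm_num) (by omega)
    (level578_sieve 7 h7 (le_refl 7)
      (fun o => M.Excludes 578 o (famBC r 17 7 (fun _ b => 2 ∣ b)) ∨ M.ExcludesStd 578 o 7)
      (Or.inl hX_orbit_578_1) (fun _ => Or.inl hX_orbit_578_2) (fun _ => Or.inl hX_orbit_578_4)
      (fun hmem => by simp at hmem) (fun hmem => by simp at hmem))
    x y z hy hxy1 hxy2

end Summit.Ventures.AbcSig
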